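import Literature.NumberTheory.GaloisRepresentations.IdeleLocalInvariantsInflation
import Literature.NumberTheory.GaloisRepresentations.ArchSemiLocalInflation
import Literature.NumberTheory.GaloisRepresentations.IdeleInflationInjective
import HarnessLib

/-!
# `inv(Inf c) = inv(c)`: the idèle invariants are compatible with inflation at the infinite places too, hence for the
# total invariant (Tate, C–F VII §7.3 Cor. 7.4 (b), §11.2; Serre, *Local Fields* XI §3)

Topic `NumberTheory/GaloisRepresentations`; namespace `Literature.NumberTheory.GaloisRepresentations.IdeleCohomology`.  ASSEMBLY of
`IdeleLocalInvariantsInflation.lean` (finite places: `localInv_ideleInf`), `ArchSemiLocalInflation.lean` (`map_infPlaceProj_ideleInf`),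
`IdeleInflationInjective.lean` (`ideleInf_two_injective`) and `IdeleLocalInvariantsCanonical.lean` (`exists_localInvInfAt_eq_comp`,
`addMonoidHom_eq_of_injective_of_natCard`, `localInvInf_eq_localInvInfAt`).  Theorems only (no definition, no named fact, no
instance, no notation); number fields in `Type`.

Mathematics.  At an INFINITE place `v` of `F` the summand `H²(Gal(E/F), ∏_{w∣v} E_wˣ)` has order `n_v ∈ {1, 2}` and the
invariant is its unique embedding into `ℚ/ℤ`; the semi-local inflation `Inf_v : H²(G_E, ∏ E_wˣ) → H²(G_{E'}, ∏ E'_{w'}ˣ)` is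
INJECTIVE — a class with `Inf_v x = 0` lifts to a class of `H²(G_E, J_E)` supported at `v` whose inflation has all components
zero, hence is zero, hence the class is zero because `Inf` is injective on `H²(·, J)` (`H¹(Gal(E'/E), J_{E'}) = 0`); so
`inv_v ∘ Inf_v` and `inv_v` are two injective homomorphisms from a group of order `≤ 2` into `ℚ/ℤ` and coincide.  With the
finite places (`localInv_ideleInf`): **`inv(Inf c) = inv(c)`** for the total invariant `inv = ∑_v inv_v` of
`IdeleLocalInvariants.lean`, and `invFamily(Inf c) = invFamily(c)`.

## What is formalised

* `eq_zero_of_archSemiLocalInf_eq_zero`, **`archSemiLocalInf_two_injective`**.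
* **`localInvInfAt_ideleInf`**, `localInvInf_ideleInf` (infinite places).
* **`inv_ideleInf`**: `inv E' (ideleInf F E E' 2 c) = inv E c`; `invFamily_ideleInf`.

## References
* J. W. S. Cassels, A. Fröhlich (eds.), *Algebraic Number Theory* (1967), Ch. VII (Tate) §7.3 Cor. 7.4 (b), §9.7 (14),
  §11.2 (diagram (4): `inv₂ ∘ infl = inv₁`). [CasselsFrohlichANT1967]
* J.-P. Serre, *Local Fields*, GTM 67 (1979), Ch. XI §2–§3 (class formations: `inv_E` on the union along the injective
  inflations). [SerreLocalFields1979]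
-/

-- CITATION-FIX (2026-08-27, door-c5 g15; referee g52 "(6) rider"; held copy `book:editornd-algebraic-number-theory`): the
-- References line carried "§11.2 (6)" for `inv ∘ Inf = inv` — diagram (6) [held p0233] is the complex
-- `0 → H²(L, K̄*) → H²(L, J_K̄) → ℚ/ℤ`; the compatibility of the invariants with inflation is §9.7 (14) [held p0225] and
-- the commutative square (4) of §11.2 [held p0232].  Declarations unchanged.

noncomputable section

open NumberField NumberField.InfinitePlace IsDedekindDomain CategoryTheory groupCohomology
open Literature.NumberTheory.Automorphic

namespace Literature.NumberTheory.GaloisRepresentations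

namespace IdeleCohomology

open Literature.Algebra.Homology ArchHerbrand

variable {F E E' : Type} [Field F] [NumberField F] [Field E] [NumberField E] [Field E'] [NumberField E']
  [Algebra F E] [Algebra E E'] [Algebra F E'] [IsScalarTower F E E'] [Normal F E] [IsGalois F E] [IsGalois F E']

/-- A class of `H²(G_E, ∏_{w∣v} E_wˣ)` (`v` infinite) killed by the semi-local inflation is zero: lift it to a class of
`H²(G_E, J_E)` supported at `v`; its inflation has all place components zero, hence vanishes, hence the lift vanishes
(`Inf` is injective on `H²(·, J)`). [cite: CasselsFrohlichANT1967, Ch. VII §11.2] -/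
theorem eq_zero_of_archSemiLocalInf_eq_zero (v : InfinitePlace F) (x : groupCohomology (archUnitsRep (E := E) v) 2)
    (hx : archSemiLocalInf E E' v 2 x = 0) : x = 0 := by
  obtain ⟨c, hc, hc', hc''⟩ := exists_infPlaceComponent_eq (F := F) (E := E) v 2 x
  have hInf : ideleInf F E E' 2 c = 0 := by
    refine eq_zero_of_placeComponents_eq_zero (F := F) (E := E') 2 _ (fun v' => ?_) (fun v' => ?_)
    · rw [map_placeProj_ideleInf, hc' v', map_zero]
    · by_cases hv : v' = v
      · subst hv
        rw [map_infPlaceProj_ideleInf, hc, hx]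
      · rw [map_infPlaceProj_ideleInf, hc'' v' hv, map_zero]
  have hc0 : c = 0 := ideleInf_two_injective (hInf.trans (map_zero _).symm)
  rw [← hc, hc0, map_zero]

/-- **The archimedean semi-local inflation `H²(G_E, ∏_{w∣v} E_wˣ) → H²(G_{E'}, ∏_{w'∣v} E'_{w'}ˣ)` is injective.**
[cite: CasselsFrohlichANT1967, Ch. VII §11.2] -/
theorem archSemiLocalInf_two_injective (v : InfinitePlace F) : Function.Injective (archSemiLocalInf E E' v 2) :=
  (injective_iff_map_eq_zero _).2 (eq_zero_of_archSemiLocalInf_eq_zero v)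

/-- **`inv_v` read at `w₀'` of the inflated class is `inv_v` read at `w₀' ∩ E`** at an infinite place: two injective
homomorphisms from a group of order `≤ 2` into `ℚ/ℤ` coincide. [cite: CasselsFrohlichANT1967, Ch. VII §7.3 Cor. 7.4 (b)] -/
theorem localInvInfAt_ideleInf (w₀' : InfinitePlace E') (c : groupCohomology (IdeleClassGroup.ideleRep F E) 2) :
    localInvInfAt (F := F) w₀' (ideleInf F E E' 2 c) = localInvInfAt (F := F) (w₀'.comap (algebraMap E E')) c := by
  obtain ⟨φ', hφ', h'⟩ := exists_localInvInfAt_eq_comp (F := F) (E := E') (w₀'.comap (algebraMap F E')) w₀' rfl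
  obtain ⟨φ, hφ, h⟩ := exists_localInvInfAt_eq_comp (F := F) (E := E) (w₀'.comap (algebraMap F E'))
    (w₀'.comap (algebraMap E E')) (InfinitePlace.comap_comap_tower F E E' w₀')
  have hA : Nat.card (groupCohomology (archUnitsRep (E := E) (w₀'.comap (algebraMap F E'))) 2) = 1 ∨
      Nat.card (groupCohomology (archUnitsRep (E := E) (w₀'.comap (algebraMap F E'))) 2) = 2 := by
    rw [← InfinitePlace.comap_comap_tower F E E' w₀',
      Nat.card_congr (groupCohomologyArchUnitsRepIso (F := F) (w₀'.comap (algebraMap E E')) 2).toLinearEquiv.toEquiv]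
    exact natCard_H2_archLocalUnitsRep_eq_one_or_two (F := F) _
  have key : φ'.comp (archSemiLocalInf E E' (w₀'.comap (algebraMap F E')) 2).hom.toAddMonoidHom = φ :=
    addMonoidHom_eq_of_injective_of_natCard hA (hφ'.comp (archSemiLocalInf_two_injective _)) hφ
  rw [h', map_infPlaceProj_ideleInf, h]
  exact DFunLike.congr_fun key _

/-- **`inv_v(Inf c) = inv_v(c)` at every infinite place `v` of `F`.** [cite: CasselsFrohlichANT1967, Ch. VII §7.3 Cor. 7.4 (b)] -/
theorem localInvInf_ideleInf (v : InfinitePlace F) (c : groupCohomology (IdeleClassGroup.ideleRep F E) 2) :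
    localInvInf E' v (ideleInf F E E' 2 c) = localInvInf E v c := by
  rw [localInvInf_eq_localInvInfAt (ArchHerbrand.isOver_placeOver (E := E') v),
    localInvInf_eq_localInvInfAt (isOver_iff_isOver_comap.1 (ArchHerbrand.isOver_placeOver (E := E') v))]
  exact localInvInfAt_ideleInf _ c

/-- **`inv(Inf c) = inv(c)`**: the total invariant `inv = ∑_v inv_v + ∑_{v∣∞} inv_v` of `H²(Gal(·/F), J)` is compatible with
inflation. [cite: CasselsFrohlichANT1967, Ch. VII §11.2][cite: SerreLocalFields1979, Ch. XI §3] -/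
theorem inv_ideleInf (c : groupCohomology (IdeleClassGroup.ideleRep F E) 2) : inv E' (ideleInf F E E' 2 c) = inv E c := by
  classical
  obtain ⟨T, hT⟩ := exists_finset_forall_localInv_eq_zero c
  obtain ⟨T', hT'⟩ := exists_finset_forall_localInv_eq_zero (ideleInf F E E' 2 c)
  rw [inv_eq_sum _ (T ∪ T') (fun v hv => hT' v (fun h => hv (Finset.mem_union_right _ h))),
    inv_eq_sum _ (T ∪ T') (fun v hv => hT v (fun h => hv (Finset.mem_union_left _ h)))]
  simp only [localInv_ideleInf, localInvInf_ideleInf]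

/-- **`invFamily(Inf c) = invFamily(c)`** (all local invariants at once). [cite: CasselsFrohlichANT1967, Ch. VII §7.3 Cor. 7.4 (b)] -/
theorem invFamily_ideleInf (c : groupCohomology (IdeleClassGroup.ideleRep F E) 2) :
    invFamily F E' (ideleInf F E E' 2 c) = invFamily F E c :=
  Prod.ext (funext fun v => localInv_ideleInf v c) (funext fun v => localInvInf_ideleInf v c)

end IdeleCohomology

end Literature.NumberTheory.GaloisRepresentations

end
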